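import Summits.ABC.ABC.Theorems.CongruentialReceptacleTameLocalReceptacleStubPlateauProfiles
import Literature.NumberTheory.Sieve.SmoothProfileSums
import Mathlib.Analysis.Calculus.ContDiff.RCLike

/-!
# Crux `CongruentialReceptacle.TameLocalReceptacle` (stmt-ABC-14354), line `grh-friable-cell-resolution`:
# plateau profiles with a Lipschitz constant, in `profileFn` form

Helper of the checked skeleton `Cruxes/TameLocalReceptacle/Lines/grh_friable_cell_resolution.lean`
(lead `prover-line-stmt-ABC-14354-a1-0`), consumed by the family-size glue: the plateau profiles of
`stub_plateauProfiles` (`…StubPlateauProfiles.lean`) are re-delivered as `W`-class profiles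
`profileFn c` (`Literature/NumberTheory/Sieve/SmoothProfileSums.lean`: `profileFn c v = Σ_ℓ c_ℓ W_ℓ(v)`)
together with a LIPSCHITZ CONSTANT `L`: `‖profileFn c v − profileFn c w‖ ≤ L |v − w|`.

## Proof (running log: everything below is proved, nothing is stuck)

* `stub_plateauProfiles` only exposes its profile `p` abstractly, so its construction is repeated
  (`exists_plateauBump_lipschitz`): `p` is Mathlib's smooth bump `ContDiffBump ((a+b)/2)` with radii
  `(b−a)/2 + η₀/4 < (b−a)/2 + η₀/2`, `c_ℓ = 𝓕 g(ℓ)` for `g(v) = p(v)/(v²(1−v)²)` (all the analytic work is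
  imported from `…StubPlateauProfiles.lean`: `summable_norm_fourier_mul_pow_three`,
  `hasSum_fourier_mul_twistWeight`, `tsum_bump_divC_add_intCast`, `sq_mul_bump_divC`).  NEW: the bump is
  `C¹` with compact support, hence Lipschitz (Mathlib's `ContDiff.lipschitzWith_of_hasCompactSupport`).
* `profileFn c = p` everywhere (`profileFn_eq_ofReal_of_hasSum`): on `(0, 1]` both are the sum of the same
  series; off `(0, 1]` both vanish (`profileFn_of_not_mem`, and `supp p ⊂ (a − η₀, b + η₀) ⊂ (0, 1)`).
* The `im / re / plateau / vanishing / Lipschitz` clauses are then read off from those of `p`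
  (`‖(x : ℂ) − (y : ℂ)‖ = |x − y|`).
-/

-- `Summit.<Summit>.<Problem>` is the mandated summit-side namespace (CONVENTIONS §2); for the
-- single-conjunct summit `ABC` the two coincide, so the duplicate `ABC.ABC` is deliberate.
set_option linter.dupNamespace false

noncomputable section

namespace Summit.ABC.ABC.Theorems.TameLocalReceptacle

open Real Complex MeasureTheory Set Filter
open scoped FourierTransform Topology ContDiff
open Literature.NumberTheory.Sieve.TwistedWeight Literature.NumberTheory.Sieve.SmoothArcs

/-! ## The plateau bump, with its Lipschitz constant -/

/-- **Plateau profiles in the `W`-class, with a Lipschitz constant**: for `0 < a − η₀`, `a ≤ b`,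
`b + η₀ < 1`, `η₀ > 0` there are `p : ℝ → ℝ`, `c : ℤ → ℂ`, `L ≥ 0` with `Σ ‖c_ℓ‖(1+|ℓ|)³ < ∞`,
`p(v) = Σ_ℓ c_ℓ W_ℓ(v)` on `(0, 1]`, `0 ≤ p ≤ 1`, `p = 1` on `[a, b]`, `p = 0` off `(a − η₀, b + η₀)` and
`|p(v) − p(w)| ≤ L |v − w|` (the construction of `stub_plateauProfiles` — a smooth bump — plus: a `C¹`
compactly supported function is Lipschitz). [folklore] -/
theorem exists_plateauBump_lipschitz (a b η₀ : ℝ) (hη : 0 < η₀) (ha : 0 < a - η₀) (hab : a ≤ b)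
    (hb : b + η₀ < 1) :
    ∃ (p : ℝ → ℝ) (c : ℤ → ℂ) (L : ℝ),
      Summable (fun ℓ : ℤ => ‖c ℓ‖ * (1 + |(ℓ : ℝ)|) ^ 3) ∧ 0 ≤ L ∧
      (∀ v : ℝ, v ∈ Set.Ioc (0 : ℝ) 1 → HasSum (fun ℓ : ℤ => c ℓ * twistWeight (ℓ : ℝ) v) (p v : ℂ)) ∧
      (∀ v : ℝ, 0 ≤ p v ∧ p v ≤ 1) ∧
      (∀ v ∈ Set.Icc a b, p v = 1) ∧
      (∀ v : ℝ, v ∉ Set.Ioo (a - η₀) (b + η₀) → p v = 0) ∧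
      (∀ v w : ℝ, |p v - p w| ≤ L * |v - w|) := by
  -- the bump: centre `(a+b)/2`, radii `(b−a)/2 + η₀/4 < (b−a)/2 + η₀/2`
  let P : ContDiffBump ((a + b) / 2) :=
    ⟨(b - a) / 2 + η₀ / 4, (b - a) / 2 + η₀ / 2, by linarith, by linarith⟩
  have hrIn : P.rIn = (b - a) / 2 + η₀ / 4 := rfl
  have hrOut : P.rOut = (b - a) / 2 + η₀ / 2 := rfl
  have h0 : 0 < (a + b) / 2 - P.rOut := by rw [hrOut]; linarith
  have h1 : (a + b) / 2 + P.rOut < 1 := by rw [hrOut]; linarith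
  have hgc := contDiff_bump_divC P h0 h1
  have hgs := hasCompactSupport_bump_divC P
  -- a `C¹` compactly supported function is Lipschitz
  obtain ⟨C, hC⟩ : ∃ C, LipschitzWith C (fun v : ℝ => P v) :=
    ContDiff.lipschitzWith_of_hasCompactSupport P.hasCompactSupport (P.contDiff (n := 1)) (by simp)
  refine ⟨P, fun ℓ => 𝓕 (fun v : ℝ => (((P v / (v ^ 2 * (1 - v) ^ 2) : ℝ)) : ℂ)) ℓ, C,
    summable_norm_fourier_mul_pow_three hgc hgs, C.coe_nonneg, ?_, fun v => ⟨P.nonneg, P.le_one⟩,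
    ?_, ?_, ?_⟩
  · -- the Fourier expansion on `(0, 1]`
    intro v hv
    have h := hasSum_fourier_mul_twistWeight hgc hgs hv (tsum_bump_divC_add_intCast P h0 h1 hv)
    rwa [sq_mul_bump_divC P h1 hv] at h
  · -- `p = 1` on `[a, b]`
    intro v hv
    refine P.one_of_mem_closedBall ?_
    rw [Metric.mem_closedBall, Real.dist_eq, hrIn]
    exact abs_le.2 ⟨by linarith [hv.1], by linarith [hv.2]⟩
  · -- `p = 0` off `(a − η₀, b + η₀)`
    intro v hv
    refine P.zero_of_le_dist ?_
    rw [Real.dist_eq, hrOut]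
    rcases le_or_gt v (a - η₀) with h | h
    · rw [abs_sub_comm, abs_of_nonneg (by linarith)]; linarith
    · have h' : b + η₀ ≤ v := by
        by_contra h''
        exact hv ⟨h, not_le.1 h''⟩
      rw [abs_of_nonneg (by linarith)]; linarith
  · -- Lipschitz
    intro v w
    have h := hC.dist_le_mul v w
    rwa [Real.dist_eq, Real.dist_eq] at h

/-! ## From the bump to `profileFn` -/

/-- If `p(v) = Σ_ℓ c_ℓ W_ℓ(v)` on `(0, 1]` and `p = 0` off `(0, 1]`, then `profileFn c = p` on all of `ℝ`
(off `(0, 1]` every `W_ℓ` vanishes). [folklore] -/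
theorem profileFn_eq_ofReal_of_hasSum {p : ℝ → ℝ} {c : ℤ → ℂ}
    (hsum : ∀ v : ℝ, v ∈ Set.Ioc (0 : ℝ) 1 → HasSum (fun ℓ : ℤ => c ℓ * twistWeight (ℓ : ℝ) v) (p v : ℂ))
    (hzero : ∀ v : ℝ, v ∉ Set.Ioc (0 : ℝ) 1 → p v = 0) (v : ℝ) :
    profileFn c v = (p v : ℂ) := by
  by_cases hv : v ∈ Set.Ioc (0 : ℝ) 1
  · rw [profileFn]
    exact (hsum v hv).tsum_eq
  · rw [profileFn_of_not_mem hv, hzero v hv, Complex.ofReal_zero]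

/-! ## The statement consumed by the skeleton's glue -/

/-- **Plateau profiles with a Lipschitz constant (`profileFn` form)**: for `0 < a − η₀`, `a ≤ b`,
`b + η₀ < 1`, `η₀ > 0` there are `c : ℤ → ℂ` with `Σ ‖c_ℓ‖(1+|ℓ|)³ < ∞` and `L ≥ 0` such that the
`W`-class profile `profileFn c` is real, takes values in `[0, 1]`, equals `1` on `[a, b]`, vanishes off
`(a − η₀, b + η₀)`, and is `L`-Lipschitz on `ℝ`. [folklore] -/
theorem plateauProfile_lipschitz : ∀ (a b η₀ : ℝ), 0 < η₀ → 0 < a - η₀ → a ≤ b → b + η₀ < 1 →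
    ∃ (c : ℤ → ℂ) (L : ℝ), Summable (fun ℓ : ℤ => ‖c ℓ‖ * (1 + |(ℓ : ℝ)|) ^ 3) ∧ 0 ≤ L ∧
      (∀ v : ℝ, (profileFn c v).im = 0) ∧
      (∀ v : ℝ, 0 ≤ (profileFn c v).re ∧ (profileFn c v).re ≤ 1) ∧
      (∀ v ∈ Set.Icc a b, profileFn c v = 1) ∧
      (∀ v : ℝ, v ∉ Set.Ioo (a - η₀) (b + η₀) → profileFn c v = 0) ∧
      (∀ v w : ℝ, ‖profileFn c v - profileFn c w‖ ≤ L * |v - w|) := by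
  intro a b η₀ hη ha hab hb
  obtain ⟨p, c, L, hsum, hL, hHas, h01, hplat, hzero, hlip⟩ :=
    exists_plateauBump_lipschitz a b η₀ hη ha hab hb
  -- `p = 0` off `(0, 1]`, since `(a − η₀, b + η₀) ⊂ (0, 1)`
  have hz : ∀ v : ℝ, v ∉ Set.Ioc (0 : ℝ) 1 → p v = 0 :=
    fun v hv => hzero v fun h => hv ⟨by linarith [h.1], by linarith [h.2]⟩
  have heq : ∀ v : ℝ, profileFn c v = (p v : ℂ) := profileFn_eq_ofReal_of_hasSum hHas hz
  refine ⟨c, L, hsum, hL, fun v => ?_, fun v => ?_, fun v hv => ?_, fun v hv => ?_, fun v w => ?_⟩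
  · rw [heq, Complex.ofReal_im]
  · rw [heq, Complex.ofReal_re]
    exact h01 v
  · rw [heq, hplat v hv, Complex.ofReal_one]
  · rw [heq, hzero v hv, Complex.ofReal_zero]
  · rw [heq, heq, ← Complex.ofReal_sub, Complex.norm_real, Real.norm_eq_abs]
    exact hlip v w

end Summit.ABC.ABC.Theorems.TameLocalReceptacle

end
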